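import Mathlib
import HarnessLib
import Summits.Ventures.LatticeQCDFlow.Exactness.SphereLOFlowLightCone

/-!
# Localized site terms of the exact leading-order flow: the site term of the residual slope is sup-Lipschitz on its read set, and gluing the far field costs only the cone tail — `|∫_0^c u·v_n(Φ_{0→u}x)du − ∫_0^c u·v_n(Φ_{0→u}z_n)du| ≤ (6κ²υ²/(d−1))·c²·τ_m(c)`

HONEST FRAMING: exact (Metropolis-corrected) sampling algorithms for lattice gauge theory;
figures of merit are autocorrelation/cost numbers at stated couplings and volumes; no
continuum-physics claim.

Venture `LatticeQCDFlow` (cell pub-lqcd), topic `Exactness`; FANOUT row 7 (`s0-cpn-null`: the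
S0-D1 rung — 2D CP⁹, Lüscher's LO trivializing map inside HMC, Engel–Schaefer 2011).  NEW WORK of
the cell over GEN-16's `Exactness/SphereLOFlowLightCone.lean` (the light cone of the exact LO flow in
ball form, `norm_loFlow_sub_le_of_eqOn_nball`; the read-set modulus of the local field),
`Exactness/SphereLOFlowL1Stability.lean` (`‖P_a v − P_b w‖ ≤ ‖v−w‖ + 2‖v‖‖a−b‖`) and GEN-15's
`Exactness/SphereLOFlowEffectiveAction.lean` (continuity of the flow in time); nothing is cited as a
fact.  This is the site-by-site half of the extensive floor for the reverse relative entropy of the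
exact LO flow sampler (`Exactness/SphereLOFlowEntropyFloor.lean`): GEN-15's closed form
`S_eff = cS₀ − ∫_0^c u·V₀(Φ_{0→u})du`, `V₀ = Σ_n v_n`, `v_n(y) = (2κ²/(d−1))‖p_n(y)‖²`, is a sum of site
terms each of which reads the initial configuration essentially only inside a ball — replacing the
configuration outside `nball N (m+1) n` by a reference configuration changes the `n`-th term by at
most `(6κ²υ²/(d−1))·c²·τ_m(c)`, `τ_m(c) = 2e^{Kc}(Kc)^{m+1}/(m+1)!`, `K = 3|κ|υ/(d−1)`.

## Content

* §1 `norm_localField_le_weight`; **`abs_loCarreSite_sub_le`** — `|v_n(y) − v_n(y')| ≤ (12κ²υ²/(d−1))·η`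
  for `y, y' ∈ Ω̃` with `‖y_i − y'_i‖ ≤ η` on `N n = {n} ∪ couplingNbhd U n` (`d ≥ 2`).
* §2 `continuous_loCarreSite`, `coneTail_mono`, **`norm_loFlow_sub_loFlow_piecewise_le`** (the flow at
  the sites of `N n` sees a modification outside `nball N (m+1) n` only through `τ_m(|t|)`),
  **`abs_loCarreSite_loFlow_sub_le`** (pointwise in the flow time `u ∈ [0,c]`:
  `|v_n(Φ_{0→u}x) − v_n(Φ_{0→u}z_n)| ≤ (12κ²υ²/(d−1))·τ_m(c)`), `continuous_loCarreSite_loFlow`,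
  **`abs_intervalIntegral_loCarreSite_sub_le`** (the integrated cone error of one site term);
  `dependsOn_loLocalTerm` (the localized site term `g_n(ω) = −∫_0^c u·v_n(Φ_{0→u}(ω glued to e
  outside the ball))du` reads only `nball N (m+1) n`), `continuous_loLocalTerm` (it is continuous).

NOT CLAIMED: anything about sums over sites or measures (see `SphereLOFlowEntropyFloor`); numbers.
-/

noncomputable section

namespace Summit.Ventures.LatticeQCDFlow.Exactness

open Function Set Metric MeasureTheory NormedSpace InnerProductSpace
open scoped RealInnerProductSpace Topology Nat Classical

variable {Λ : Type*} {E : Type*} [NormedAddCommGroup E] [InnerProductSpace ℝ E]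
  [FiniteDimensional ℝ E] [Fintype Λ] [DecidableEq Λ]


/-! ## §1 The site term of the residual slope is sup-Lipschitz on its read set -/

section SiteTerm

variable {U : Λ → Λ → (E →L[ℝ] E)}

omit [FiniteDimensional ℝ E] [DecidableEq Λ] in
/-- `‖J_n(y)‖ ≤ υ` on `Ω̃` under the local weight bound. -/
theorem norm_localField_le_weight {υ : ℝ} (hυ : ∀ k, ∑ m, ‖U k m‖ ≤ υ) (n : Λ) {y : Λ → E}
    (hy : ∀ i, ‖y i‖ = 1) : ‖localField U n y‖ ≤ υ := by
  unfold localField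
  refine (norm_sum_le _ _).trans ((Finset.sum_le_sum fun m _ => ?_).trans (hυ n))
  calc ‖U n m (y m)‖ ≤ ‖U n m‖ * ‖y m‖ := (U n m).le_opNorm (y m)
    _ = ‖U n m‖ := by rw [hy m, mul_one]

omit [FiniteDimensional ℝ E] [DecidableEq Λ] in
/-- **The site term `v_n(y) = (2κ²/(d−1))‖p_n(y)‖²` is sup-Lipschitz on its read set `N n`**:
`|v_n(y) − v_n(y')| ≤ (12κ²υ²/(d−1))·η` for `y, y' ∈ Ω̃` with `‖y_i − y'_i‖ ≤ η` on
`N n = {n} ∪ couplingNbhd U n` (`d ≥ 2`). -/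
theorem abs_loCarreSite_sub_le (hd : 2 ≤ Module.finrank ℝ E) (κ : ℝ) {υ : ℝ}
    (hυ : ∀ k, ∑ m, ‖U k m‖ ≤ υ) (n : Λ) {y y' : Λ → E} (hy : ∀ i, ‖y i‖ = 1)
    (hy' : ∀ i, ‖y' i‖ = 1) {η : ℝ} (hη : 0 ≤ η)
    (hN : ∀ j ∈ insert n (couplingNbhd U n), ‖y j - y' j‖ ≤ η) :
    |2 * κ ^ 2 / ((Module.finrank ℝ E : ℝ) - 1) * ‖tangentKick (localField U n y) (y n)‖ ^ 2 -
        2 * κ ^ 2 / ((Module.finrank ℝ E : ℝ) - 1) * ‖tangentKick (localField U n y') (y' n)‖ ^ 2| ≤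
      12 * κ ^ 2 * υ ^ 2 / ((Module.finrank ℝ E : ℝ) - 1) * η := by
  have hd1 : (0 : ℝ) < (Module.finrank ℝ E : ℝ) - 1 := by
    have : (2 : ℝ) ≤ Module.finrank ℝ E := by exact_mod_cast hd
    linarith
  have hυ0 : 0 ≤ υ := le_trans (Finset.sum_nonneg fun m _ => norm_nonneg _) (hυ n)
  set p := tangentKick (localField U n y) (y n) with hp
  set p' := tangentKick (localField U n y') (y' n) with hp'
  have hpυ : ‖p‖ ≤ υ := (norm_tangentKick_localField_le U hy n).trans (hυ n)
  have hp'υ : ‖p'‖ ≤ υ := (norm_tangentKick_localField_le U hy' n).trans (hυ n)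
  -- `‖p − p'‖ ≤ 3υη`
  have hJ : ‖localField U n y - localField U n y'‖ ≤ υ * η :=
    norm_localField_sub_le_of_readSet hυ n hη hN
  have hJυ : ‖localField U n y‖ ≤ υ := norm_localField_le_weight hυ n hy
  have hnn : ‖y n - y' n‖ ≤ η := hN n (mem_insert _ _)
  have hpp' : ‖p - p'‖ ≤ 3 * υ * η := by
    have h := norm_tangentKick_sub_tangentKick_le (hy n) (hy' n) (localField U n y) (localField U n y')
    calc ‖p - p'‖ ≤ ‖localField U n y - localField U n y'‖ + 2 * ‖localField U n y‖ * ‖y n - y' n‖ := h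
      _ ≤ υ * η + 2 * υ * η := by
          gcongr
      _ = 3 * υ * η := by ring
  -- `|‖p‖² − ‖p'‖²| ≤ 2υ·3υη`
  have hsq : |‖p‖ ^ 2 - ‖p'‖ ^ 2| ≤ 6 * υ ^ 2 * η := by
    rw [sq_sub_sq, abs_mul]
    have h1 : |‖p‖ + ‖p'‖| ≤ 2 * υ := by
      rw [abs_of_nonneg (by positivity)]; linarith
    have h2 : |‖p‖ - ‖p'‖| ≤ 3 * υ * η := (abs_norm_sub_norm_le p p').trans hpp'
    calc |‖p‖ + ‖p'‖| * |‖p‖ - ‖p'‖| ≤ (2 * υ) * (3 * υ * η) :=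
          mul_le_mul h1 h2 (abs_nonneg _) (by positivity)
      _ = 6 * υ ^ 2 * η := by ring
  rw [← mul_sub, abs_mul, abs_of_nonneg (div_nonneg (by positivity) hd1.le)]
  calc 2 * κ ^ 2 / ((Module.finrank ℝ E : ℝ) - 1) * |‖p‖ ^ 2 - ‖p'‖ ^ 2|
      ≤ 2 * κ ^ 2 / ((Module.finrank ℝ E : ℝ) - 1) * (6 * υ ^ 2 * η) :=
        mul_le_mul_of_nonneg_left hsq (div_nonneg (by positivity) hd1.le)
    _ = 12 * κ ^ 2 * υ ^ 2 / ((Module.finrank ℝ E : ℝ) - 1) * η := by ring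

end SiteTerm

/-! ## §2 Localized site terms of the effective action and their cone error -/

section Local

variable {U : Λ → Λ → (E →L[ℝ] E)} {T : ℝ}

omit [FiniteDimensional ℝ E] [DecidableEq Λ] in
/-- The site term `y ↦ v_n(y)` is continuous. -/
theorem continuous_loCarreSite (κ : ℝ) (n : Λ) :
    Continuous fun y : Λ → E =>
      2 * κ ^ 2 / ((Module.finrank ℝ E : ℝ) - 1) * ‖tangentKick (localField U n y) (y n)‖ ^ 2 := by
  have hJ : Continuous fun y : Λ → E => localField U n y := (contDiff_localField U n (m := 0)).continuous
  have hx : Continuous fun y : Λ → E => y n := continuous_apply n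
  have h : Continuous fun y : Λ → E => tangentKick (localField U n y) (y n) := by
    unfold tangentKick
    exact hJ.sub ((hJ.inner hx).smul hx)
  exact continuous_const.mul ((h.norm).pow 2)

/-- The cone tail `τ_m(u) = 2e^{Ku}(Ku)^{m+1}/(m+1)!` is monotone in `u ≥ 0` (`K ≥ 0`). -/
theorem coneTail_mono {K : ℝ} (hK : 0 ≤ K) (m : ℕ) {u c : ℝ} (hu : 0 ≤ u) (huc : u ≤ c) :
    2 * Real.exp (K * u) * (K * u) ^ (m + 1) / ((m + 1)! : ℝ) ≤
      2 * Real.exp (K * c) * (K * c) ^ (m + 1) / ((m + 1)! : ℝ) := by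
  have h1 : Real.exp (K * u) ≤ Real.exp (K * c) := Real.exp_le_exp.2 (by nlinarith)
  have h2 : (K * u) ^ (m + 1) ≤ (K * c) ^ (m + 1) :=
    pow_le_pow_left₀ (by positivity) (by nlinarith) _
  have h3 : 2 * Real.exp (K * u) * (K * u) ^ (m + 1) ≤ 2 * Real.exp (K * c) * (K * c) ^ (m + 1) :=
    mul_le_mul (by linarith) h2 (by positivity) (by positivity)
  exact div_le_div_of_nonneg_right h3 (by positivity)

/-- **The flow at the read set of `n` sees the far field only through the cone tail**: for
`x, e ∈ Ω̃`, `i ∈ N n` and any time `t`, replacing `x` by `e` OUTSIDE `nball N (m+1) n` moves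
`Φ_{0→t}(x)_i` by at most `τ_m(|t|) = 2e^{K|t|}(K|t|)^{m+1}/(m+1)!` (the light cone of the exact LO
flow, `SphereLOFlowLightCone`, since the two inputs agree on `nball N m i ⊆ nball N (m+1) n`). -/
theorem norm_loFlow_sub_loFlow_piecewise_le (hU0 : ∀ n, U n n = 0)
    (hUadj : ∀ m n (v w : E), ⟪U m n v, w⟫ = ⟪v, U n m w⟫) (hd : 2 ≤ Module.finrank ℝ E)
    (κ S₀ : ℝ) {υ : ℝ} (hυ : ∀ k, ∑ m, ‖U k m‖ ≤ υ) {x e : Λ → E} (hx : ∀ n, ‖x n‖ = 1)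
    (he : ∀ n, ‖e n‖ = 1) (t : ℝ) (n : Λ) (m : ℕ) {i : Λ} (hi : i ∈ insert n (couplingNbhd U n)) :
    ‖sphereTDFlow (G := fun _ : ℝ => loFlowAction κ S₀ U)
          (contDiff_const_family (contDiff_loFlowAction U κ S₀)) T 0 t x i -
        sphereTDFlow (G := fun _ : ℝ => loFlowAction κ S₀ U)
          (contDiff_const_family (contDiff_loFlowAction U κ S₀)) T 0 t
          ((nball (fun k => insert k (couplingNbhd U k)) (m + 1) n).piecewise x e) i‖ ≤
      2 * Real.exp (3 * |κ| * υ / ((Module.finrank ℝ E : ℝ) - 1) * |t|) *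
        (3 * |κ| * υ / ((Module.finrank ℝ E : ℝ) - 1) * |t|) ^ (m + 1) / ((m + 1)! : ℝ) := by
  set N : Λ → Set Λ := fun k => insert k (couplingNbhd U k) with hN
  have hz : ∀ k, ‖(nball N (m + 1) n).piecewise x e k‖ = 1 := by
    intro k
    by_cases hk : k ∈ nball N (m + 1) n
    · rw [Set.piecewise_eq_of_mem _ _ _ hk]; exact hx k
    · rw [Set.piecewise_eq_of_notMem _ _ _ hk]; exact he k
  have hsub : nball N m i ⊆ nball N (m + 1) n := by
    have hi1 : i ∈ nball N 1 n := by
      rcases (Set.mem_insert_iff).1 hi with h | h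
      · rw [h]; exact self_mem_nball 1 n
      · exact subset_nball_one n (by simpa [hN] using Set.mem_insert_of_mem n h)
    have h := nball_subset_nball_add hi1 m
    rwa [add_comm] at h
  have hagree : ∀ j ∈ nball N m i, x j = (nball N (m + 1) n).piecewise x e j :=
    fun j hj => (Set.piecewise_eq_of_mem _ _ _ (hsub hj)).symm
  have h := norm_loFlow_sub_le_of_eqOn_nball hU0 hUadj hd κ S₀ hυ hx hz 0 t i m hagree (T := T)
  rwa [sub_zero] at h

/-- **Each localized site term is within `(12κ²υ²/(d−1))·τ_m(c)` of the true one, pointwise in the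
flow time `u ∈ [0, c]`**: `|v_n(Φ_{0→u}x) − v_n(Φ_{0→u}z_n)| ≤ (12κ²υ²/(d−1))·τ_m(c)`, `z_n` the
configuration glued to `e` outside `nball N (m+1) n`. -/
theorem abs_loCarreSite_loFlow_sub_le (hU0 : ∀ n, U n n = 0)
    (hUadj : ∀ m n (v w : E), ⟪U m n v, w⟫ = ⟪v, U n m w⟫) (hd : 2 ≤ Module.finrank ℝ E)
    (κ S₀ : ℝ) {υ : ℝ} (hυ : ∀ k, ∑ m, ‖U k m‖ ≤ υ) {x e : Λ → E} (hx : ∀ n, ‖x n‖ = 1)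
    (he : ∀ n, ‖e n‖ = 1) (n : Λ) (m : ℕ) {u c : ℝ} (hu : 0 ≤ u) (huc : u ≤ c) :
    |2 * κ ^ 2 / ((Module.finrank ℝ E : ℝ) - 1) *
          ‖tangentKick (localField U n (sphereTDFlow (G := fun _ : ℝ => loFlowAction κ S₀ U)
            (contDiff_const_family (contDiff_loFlowAction U κ S₀)) T 0 u x))
            (sphereTDFlow (G := fun _ : ℝ => loFlowAction κ S₀ U)
              (contDiff_const_family (contDiff_loFlowAction U κ S₀)) T 0 u x n)‖ ^ 2 -
        2 * κ ^ 2 / ((Module.finrank ℝ E : ℝ) - 1) *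
          ‖tangentKick (localField U n (sphereTDFlow (G := fun _ : ℝ => loFlowAction κ S₀ U)
            (contDiff_const_family (contDiff_loFlowAction U κ S₀)) T 0 u
            ((nball (fun k => insert k (couplingNbhd U k)) (m + 1) n).piecewise x e)))
            (sphereTDFlow (G := fun _ : ℝ => loFlowAction κ S₀ U)
              (contDiff_const_family (contDiff_loFlowAction U κ S₀)) T 0 u
              ((nball (fun k => insert k (couplingNbhd U k)) (m + 1) n).piecewise x e) n)‖ ^ 2| ≤
      12 * κ ^ 2 * υ ^ 2 / ((Module.finrank ℝ E : ℝ) - 1) *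
        (2 * Real.exp (3 * |κ| * υ / ((Module.finrank ℝ E : ℝ) - 1) * c) *
          (3 * |κ| * υ / ((Module.finrank ℝ E : ℝ) - 1) * c) ^ (m + 1) / ((m + 1)! : ℝ)) := by
  set N : Λ → Set Λ := fun k => insert k (couplingNbhd U k) with hN
  set K : ℝ := 3 * |κ| * υ / ((Module.finrank ℝ E : ℝ) - 1) with hK
  have hd1 : (0 : ℝ) < (Module.finrank ℝ E : ℝ) - 1 := by
    have : (2 : ℝ) ≤ Module.finrank ℝ E := by exact_mod_cast hd
    linarith
  have hυ0 : 0 ≤ υ := le_trans (Finset.sum_nonneg fun m _ => norm_nonneg _) (hυ n)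
  have hK0 : 0 ≤ K := by rw [hK]; exact div_nonneg (by positivity) hd1.le
  have hz : ∀ k, ‖(nball N (m + 1) n).piecewise x e k‖ = 1 := by
    intro k
    by_cases hk : k ∈ nball N (m + 1) n
    · rw [Set.piecewise_eq_of_mem _ _ _ hk]; exact hx k
    · rw [Set.piecewise_eq_of_notMem _ _ _ hk]; exact he k
  have hΦx : ∀ k, ‖sphereTDFlow (G := fun _ : ℝ => loFlowAction κ S₀ U)
      (contDiff_const_family (contDiff_loFlowAction U κ S₀)) T 0 u x k‖ = 1 :=
    fun k => norm_sphereTDFlow_eq_one _ 0 hx u k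
  have hΦz : ∀ k, ‖sphereTDFlow (G := fun _ : ℝ => loFlowAction κ S₀ U)
      (contDiff_const_family (contDiff_loFlowAction U κ S₀)) T 0 u
      ((nball N (m + 1) n).piecewise x e) k‖ = 1 :=
    fun k => norm_sphereTDFlow_eq_one _ 0 hz u k
  have hτ0 : 0 ≤ 2 * Real.exp (K * c) * (K * c) ^ (m + 1) / ((m + 1)! : ℝ) := by
    have : 0 ≤ K * c := mul_nonneg hK0 (hu.trans huc)
    positivity
  refine abs_loCarreSite_sub_le hd κ hυ n hΦx hΦz hτ0 fun j hj => ?_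
  have h := norm_loFlow_sub_loFlow_piecewise_le hU0 hUadj hd κ S₀ hυ hx he u n m hj (T := T)
  rw [abs_of_nonneg hu] at h
  exact h.trans (coneTail_mono hK0 m hu huc)

/-- `u ↦ v_n(Φ_{0→u} y)` is continuous (for the interval integrals below). -/
theorem continuous_loCarreSite_loFlow (κ S₀ : ℝ) (n : Λ) (y : Λ → E) :
    Continuous fun u : ℝ => 2 * κ ^ 2 / ((Module.finrank ℝ E : ℝ) - 1) *
      ‖tangentKick (localField U n (sphereTDFlow (G := fun _ : ℝ => loFlowAction κ S₀ U)
        (contDiff_const_family (contDiff_loFlowAction U κ S₀)) T 0 u y))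
        (sphereTDFlow (G := fun _ : ℝ => loFlowAction κ S₀ U)
          (contDiff_const_family (contDiff_loFlowAction U κ S₀)) T 0 u y n)‖ ^ 2 :=
  (continuous_loCarreSite (U := U) κ n).comp (continuous_sphereTDFlow_time _ 0 y)

/-- **THE INTEGRATED CONE ERROR OF ONE LOCALIZED SITE TERM**: for `x, e ∈ Ω̃` and `0 ≤ c`,
`|∫_0^c u·v_n(Φ_{0→u}x)du − ∫_0^c u·v_n(Φ_{0→u}z_n)du| ≤ (6κ²υ²/(d−1))·c²·τ_m(c)`. -/
theorem abs_intervalIntegral_loCarreSite_sub_le (hU0 : ∀ n, U n n = 0)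
    (hUadj : ∀ m n (v w : E), ⟪U m n v, w⟫ = ⟪v, U n m w⟫) (hd : 2 ≤ Module.finrank ℝ E)
    (κ S₀ : ℝ) {υ : ℝ} (hυ : ∀ k, ∑ m, ‖U k m‖ ≤ υ) {x e : Λ → E} (hx : ∀ n, ‖x n‖ = 1)
    (he : ∀ n, ‖e n‖ = 1) (n : Λ) (m : ℕ) {c : ℝ} (hc0 : 0 ≤ c) :
    |(∫ u in (0 : ℝ)..c, u * (2 * κ ^ 2 / ((Module.finrank ℝ E : ℝ) - 1) *
          ‖tangentKick (localField U n (sphereTDFlow (G := fun _ : ℝ => loFlowAction κ S₀ U)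
            (contDiff_const_family (contDiff_loFlowAction U κ S₀)) T 0 u x))
            (sphereTDFlow (G := fun _ : ℝ => loFlowAction κ S₀ U)
              (contDiff_const_family (contDiff_loFlowAction U κ S₀)) T 0 u x n)‖ ^ 2)) -
        ∫ u in (0 : ℝ)..c, u * (2 * κ ^ 2 / ((Module.finrank ℝ E : ℝ) - 1) *
          ‖tangentKick (localField U n (sphereTDFlow (G := fun _ : ℝ => loFlowAction κ S₀ U)
            (contDiff_const_family (contDiff_loFlowAction U κ S₀)) T 0 u
            ((nball (fun k => insert k (couplingNbhd U k)) (m + 1) n).piecewise x e)))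
            (sphereTDFlow (G := fun _ : ℝ => loFlowAction κ S₀ U)
              (contDiff_const_family (contDiff_loFlowAction U κ S₀)) T 0 u
              ((nball (fun k => insert k (couplingNbhd U k)) (m + 1) n).piecewise x e) n)‖ ^ 2)| ≤
      6 * κ ^ 2 * υ ^ 2 / ((Module.finrank ℝ E : ℝ) - 1) * c ^ 2 *
        (2 * Real.exp (3 * |κ| * υ / ((Module.finrank ℝ E : ℝ) - 1) * c) *
          (3 * |κ| * υ / ((Module.finrank ℝ E : ℝ) - 1) * c) ^ (m + 1) / ((m + 1)! : ℝ)) := by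
  set N : Λ → Set Λ := fun k => insert k (couplingNbhd U k) with hN
  set z : Λ → E := (nball N (m + 1) n).piecewise x e with hzdef
  set L : ℝ := 12 * κ ^ 2 * υ ^ 2 / ((Module.finrank ℝ E : ℝ) - 1) *
    (2 * Real.exp (3 * |κ| * υ / ((Module.finrank ℝ E : ℝ) - 1) * c) *
      (3 * |κ| * υ / ((Module.finrank ℝ E : ℝ) - 1) * c) ^ (m + 1) / ((m + 1)! : ℝ)) with hL
  set f : ℝ → ℝ := fun u => 2 * κ ^ 2 / ((Module.finrank ℝ E : ℝ) - 1) *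
    ‖tangentKick (localField U n (sphereTDFlow (G := fun _ : ℝ => loFlowAction κ S₀ U)
      (contDiff_const_family (contDiff_loFlowAction U κ S₀)) T 0 u x))
      (sphereTDFlow (G := fun _ : ℝ => loFlowAction κ S₀ U)
        (contDiff_const_family (contDiff_loFlowAction U κ S₀)) T 0 u x n)‖ ^ 2 with hf
  set g : ℝ → ℝ := fun u => 2 * κ ^ 2 / ((Module.finrank ℝ E : ℝ) - 1) *
    ‖tangentKick (localField U n (sphereTDFlow (G := fun _ : ℝ => loFlowAction κ S₀ U)
      (contDiff_const_family (contDiff_loFlowAction U κ S₀)) T 0 u z))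
      (sphereTDFlow (G := fun _ : ℝ => loFlowAction κ S₀ U)
        (contDiff_const_family (contDiff_loFlowAction U κ S₀)) T 0 u z n)‖ ^ 2 with hg
  have hfc : Continuous f := continuous_loCarreSite_loFlow (U := U) κ S₀ n x (T := T)
  have hgc : Continuous g := continuous_loCarreSite_loFlow (U := U) κ S₀ n z (T := T)
  have hfi : IntervalIntegrable (fun u => u * f u) volume 0 c :=
    (continuous_id.mul hfc).intervalIntegrable _ _
  have hgi : IntervalIntegrable (fun u => u * g u) volume 0 c :=
    (continuous_id.mul hgc).intervalIntegrable _ _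
  change |(∫ u in (0 : ℝ)..c, u * f u) - ∫ u in (0 : ℝ)..c, u * g u| ≤
    6 * κ ^ 2 * υ ^ 2 / ((Module.finrank ℝ E : ℝ) - 1) * c ^ 2 *
      (2 * Real.exp (3 * |κ| * υ / ((Module.finrank ℝ E : ℝ) - 1) * c) *
        (3 * |κ| * υ / ((Module.finrank ℝ E : ℝ) - 1) * c) ^ (m + 1) / ((m + 1)! : ℝ))
  rw [← intervalIntegral.integral_sub hfi hgi]
  have hpt : ∀ u ∈ Set.Icc 0 c, |u * f u - u * g u| ≤ u * L := by
    intro u hu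
    rw [← mul_sub, abs_mul, abs_of_nonneg hu.1]
    exact mul_le_mul_of_nonneg_left
      (abs_loCarreSite_loFlow_sub_le hU0 hUadj hd κ S₀ hυ hx he n m hu.1 hu.2 (T := T)) hu.1
  have h1 : |∫ u in (0 : ℝ)..c, (u * f u - u * g u)| ≤ ∫ u in (0 : ℝ)..c, |u * f u - u * g u| :=
    intervalIntegral.abs_integral_le_integral_abs hc0
  have h2 : ∫ u in (0 : ℝ)..c, |u * f u - u * g u| ≤ ∫ u in (0 : ℝ)..c, u * L := by
    refine intervalIntegral.integral_mono_on hc0 ?_ ?_ hpt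
    · exact ((continuous_id.mul hfc).sub (continuous_id.mul hgc)).abs.intervalIntegrable _ _
    · exact (continuous_id.mul continuous_const).intervalIntegrable _ _
  have h3 : ∫ u in (0 : ℝ)..c, u * L = c ^ 2 / 2 * L := by
    rw [intervalIntegral.integral_mul_const, integral_id]; ring
  calc |∫ u in (0 : ℝ)..c, (u * f u - u * g u)| ≤ c ^ 2 / 2 * L := by linarith
    _ = _ := by rw [hL]; ring

/-- **The localized site term depends only on the ball `nball N (m+1) n`.** -/
theorem dependsOn_loLocalTerm (κ S₀ : ℝ) (e : Λ → E) (m : ℕ) (c : ℝ)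
    {g : Λ → (Λ → sphere (0 : E) 1) → ℝ}
    (hg : ∀ n ω, g n ω = -∫ u in (0 : ℝ)..c, u * (2 * κ ^ 2 / ((Module.finrank ℝ E : ℝ) - 1) *
      ‖tangentKick (localField U n (sphereTDFlow (G := fun _ : ℝ => loFlowAction κ S₀ U)
          (contDiff_const_family (contDiff_loFlowAction U κ S₀)) T 0 u
          ((nball (fun k => insert k (couplingNbhd U k)) (m + 1) n).piecewise
            (fun i => ((ω i : sphere (0 : E) 1) : E)) e)))
        (sphereTDFlow (G := fun _ : ℝ => loFlowAction κ S₀ U)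
          (contDiff_const_family (contDiff_loFlowAction U κ S₀)) T 0 u
          ((nball (fun k => insert k (couplingNbhd U k)) (m + 1) n).piecewise
            (fun i => ((ω i : sphere (0 : E) 1) : E)) e) n)‖ ^ 2))
    (n : Λ) : DependsOn (g n) (nball (fun k => insert k (couplingNbhd U k)) (m + 1) n) := by
  intro ω ω' hagree
  rw [hg n ω, hg n ω']
  have hcfg : (nball (fun k => insert k (couplingNbhd U k)) (m + 1) n).piecewise
      (fun i => ((ω i : sphere (0 : E) 1) : E)) e =
      (nball (fun k => insert k (couplingNbhd U k)) (m + 1) n).piecewise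
        (fun i => ((ω' i : sphere (0 : E) 1) : E)) e := by
    funext j
    by_cases hj : j ∈ nball (fun k => insert k (couplingNbhd U k)) (m + 1) n
    · rw [Set.piecewise_eq_of_mem _ _ _ hj, Set.piecewise_eq_of_mem _ _ _ hj, hagree j hj]
    · rw [Set.piecewise_eq_of_notMem _ _ _ hj, Set.piecewise_eq_of_notMem _ _ _ hj]
  rw [hcfg]

/-- **The localized site term is continuous in the configuration** (a parametric interval integral
of a jointly continuous integrand: the flow is jointly `C¹` in time and initial condition). -/
theorem continuous_loLocalTerm (κ S₀ : ℝ) (e : Λ → E) (m : ℕ) (c : ℝ)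
    {g : Λ → (Λ → sphere (0 : E) 1) → ℝ}
    (hg : ∀ n ω, g n ω = -∫ u in (0 : ℝ)..c, u * (2 * κ ^ 2 / ((Module.finrank ℝ E : ℝ) - 1) *
      ‖tangentKick (localField U n (sphereTDFlow (G := fun _ : ℝ => loFlowAction κ S₀ U)
          (contDiff_const_family (contDiff_loFlowAction U κ S₀)) T 0 u
          ((nball (fun k => insert k (couplingNbhd U k)) (m + 1) n).piecewise
            (fun i => ((ω i : sphere (0 : E) 1) : E)) e)))
        (sphereTDFlow (G := fun _ : ℝ => loFlowAction κ S₀ U)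
          (contDiff_const_family (contDiff_loFlowAction U κ S₀)) T 0 u
          ((nball (fun k => insert k (couplingNbhd U k)) (m + 1) n).piecewise
            (fun i => ((ω i : sphere (0 : E) 1) : E)) e) n)‖ ^ 2))
    (n : Λ) : Continuous (g n) := by
  have hfun : g n = fun ω => -∫ u in (0 : ℝ)..c, u * (2 * κ ^ 2 / ((Module.finrank ℝ E : ℝ) - 1) *
      ‖tangentKick (localField U n (sphereTDFlow (G := fun _ : ℝ => loFlowAction κ S₀ U)
          (contDiff_const_family (contDiff_loFlowAction U κ S₀)) T 0 u
          ((nball (fun k => insert k (couplingNbhd U k)) (m + 1) n).piecewise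
            (fun i => ((ω i : sphere (0 : E) 1) : E)) e)))
        (sphereTDFlow (G := fun _ : ℝ => loFlowAction κ S₀ U)
          (contDiff_const_family (contDiff_loFlowAction U κ S₀)) T 0 u
          ((nball (fun k => insert k (couplingNbhd U k)) (m + 1) n).piecewise
            (fun i => ((ω i : sphere (0 : E) 1) : E)) e) n)‖ ^ 2) := funext (hg n)
  rw [hfun]
  -- the glued configuration is continuous in `ω`
  have hz : Continuous fun ω : Λ → sphere (0 : E) 1 =>
      (nball (fun k => insert k (couplingNbhd U k)) (m + 1) n).piecewise
        (fun i => ((ω i : sphere (0 : E) 1) : E)) e := by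
    refine continuous_pi fun j => ?_
    by_cases hj : j ∈ nball (fun k => insert k (couplingNbhd U k)) (m + 1) n
    · simp only [Set.piecewise_eq_of_mem _ _ _ hj]
      exact continuous_subtype_val.comp (continuous_apply j)
    · simp only [Set.piecewise_eq_of_notMem _ _ _ hj]
      exact continuous_const
  -- the flow is jointly continuous in (time, initial condition)
  have hΦ : Continuous fun p : (Λ → sphere (0 : E) 1) × ℝ =>
      sphereTDFlow (G := fun _ : ℝ => loFlowAction κ S₀ U)
        (contDiff_const_family (contDiff_loFlowAction U κ S₀)) T 0 p.2
        ((nball (fun k => insert k (couplingNbhd U k)) (m + 1) n).piecewise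
          (fun i => ((p.1 i : sphere (0 : E) 1) : E)) e) := by
    have hj := (contDiff_sphereTDFlow (G := fun _ : ℝ => loFlowAction κ S₀ U)
      (contDiff_const_family (contDiff_loFlowAction U κ S₀)) (T := T)).continuous
    exact hj.comp (continuous_const.prodMk (continuous_snd.prodMk (hz.comp continuous_fst)))
  have hunc : Continuous (Function.uncurry fun (ω : Λ → sphere (0 : E) 1) (u : ℝ) =>
      u * (2 * κ ^ 2 / ((Module.finrank ℝ E : ℝ) - 1) *
      ‖tangentKick (localField U n (sphereTDFlow (G := fun _ : ℝ => loFlowAction κ S₀ U)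
          (contDiff_const_family (contDiff_loFlowAction U κ S₀)) T 0 u
          ((nball (fun k => insert k (couplingNbhd U k)) (m + 1) n).piecewise
            (fun i => ((ω i : sphere (0 : E) 1) : E)) e)))
        (sphereTDFlow (G := fun _ : ℝ => loFlowAction κ S₀ U)
          (contDiff_const_family (contDiff_loFlowAction U κ S₀)) T 0 u
          ((nball (fun k => insert k (couplingNbhd U k)) (m + 1) n).piecewise
            (fun i => ((ω i : sphere (0 : E) 1) : E)) e) n)‖ ^ 2)) :=
    continuous_snd.mul ((continuous_loCarreSite (U := U) κ n).comp hΦ)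
  exact (intervalIntegral.continuous_parametric_intervalIntegral_of_continuous' hunc 0 c).neg

end Local

end Summit.Ventures.LatticeQCDFlow.Exactness

end
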